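/-
Copyright (c) 2026 the pub-hodgecm-mathlib formalisation cell (harness21).  Prover seat hodgecm-mathlib-R90-C14-p03 (g3) (section S6 «Rogawski Ch. 14», dealer R90-C14-plan (g3),
card «(E1) FRAME LETTERS AT THE PLACE» (RULINGS #22 (R58), R90 bus 2026-09-05T03:56:49Z); census `R90/R90-C14-p03/g3/CENSUS-E1-frame-at-Lw.md` ef324be44de670d6).
THEOREMS ONLY (no `def`, no `instance`, no notation, no named-fact hypothesis, no `sorry`); lane `--supports stmt-HodgeConjecture-24833 --as helper` (count-neutral helper).
-/
import Literature.NumberTheory.Automorphic.UnitaryLatticeTreeValencyInertPlace            -- ★ `galAdicCompletionMap_mem_valuedInteger`, `exists_residueField_ringHom_of_v_eq`, `fintypeCard_valuedResidueField_eq_sq_of_inert`, `residueHom_galAdicCompletionMap_eq_pow_valued`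
import Literature.NumberTheory.LocalFields.UnramifiedQuadraticNormAtInertPlaceValued        -- ★ `exists_mul_galAdicCompletionMap_eq_of_valued_eq_one` (`U_{F_v} = N U_{E_w}`, `Valued` currency)
import Literature.NumberTheory.Automorphic.UnitaryGroupInertPlaceHyperbolicBasis             -- ★ `galAdicCompletionMap_galAdicCompletionMap_of_smul_eq` (`σ_w² = 1`)
import Literature.NumberTheory.Automorphic.SymplecticGroupCartanUnique                       -- ★ `CartanUnique.isUnit_integer_iff`, `irreducible_uniformizer`, `isDiscreteValuationRing_integer`
import Literature.LinearAlgebra.Matrix.FiniteFieldHermitianAnisotropic                       -- ★ `exists_frob_ne` (`Frob_q ≠ id` on `𝔽_{q²}`)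
import HarnessLib

/-!
# R90-TF §S6 — THE (E1) FRAME LETTERS AT AN INERT PLACE: `y·σ_w y = −2`, the unit mover `a₀` in `Valued` currency, and the `R := 𝒪[E_w]` frame one-liners

The (E1) κ-identity head of the S6 cell (typ1 (g3) sheet v2.3 `delta_mul_kappaSum_ncard_displaced_flicker_eq_sum_xiHCoeff_mul_ncard_displaced_two`) carries, besides its
counting data, the ★ a₀ ∕ FILE 0 (H.1) FRAME BLOCK: `hy : y·σy = −2`, the unit mover `a₀ ∈ 𝒪[K]` with `σa₀ − a₀ ∈ 𝒪^×` (in the `Valued` valuation ring `𝒪[K] = Valued.integer K`),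
and an abstract complete d.v.r. `R` with `ι : R →+* K`, `hιv : |x| ≤ 1 ↔ x ∈ range ι`, `σR`, `dR`, `ϖR`, `hqR`.  The census (HOME `CENSUS-E1-frame-at-Lw.md`) finds every other
non-count binder ★ BY NAME at an inert place `v ∤ 2`; this file supplies the three pieces of glue that had no ★ name, at a GENERIC inert place `w ∣ v` of a quadratic extension
`E ∕ F` of number fields (`c` the non-trivial `F`-automorphism, `c • w = w`, `v` unramified in `E`; CM socket `F := L⁺`, `E := L`, `c := complexConj`), `E_w = w.1.adicCompletion E`,
`σ_w = galAdicCompletionMap c hw`: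

* §1 (any `[Valued K ℤᵐ⁰]`, the frame `R := 𝒪[K]`, `ι := 𝒪[K].subtype`, `σR := σ|_𝒪`): **`v_le_one_iff_mem_range_integer_subtype`** (`hιv`), **`restrictInteger_restrictInteger`**
  (`hσR` from `σ² = 1`), **`restrictInteger_sub_self_eq_neg`** (`hdRσ` for `dR := σa₀ − a₀`), **`isUnit_two_integer_of_v_eq_one`** (`h2R`); `hqR` is ★ (G1) 3a
  `natCard_residueField_eq_of_card`, `hσι`, `hιϖ` are `rfl`, `hϖR` is ★ `CartanUnique.irreducible_uniformizer`, the instances are ★ `CartanUnique.isDiscreteValuationRing_integer` ∕ ★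
  `isAdicComplete_valuedInteger_of_completeSpace` ∕ ★ `finite_residueField_adicCompletion`.
* §2 (at the place): **`valued_two_eq_one_of_not_mem_placesOver`** (`|2|_w = 1` for `v ∤ 2`, generic twin of the ★ CM lemma), **`exists_mul_galAdicCompletionMap_eq_neg_two`**
  (`hy`: `−2` is a `σ_w`-fixed unit, hence a norm from the unramified `E_w ∕ F_v`, ★ `exists_mul_galAdicCompletionMap_eq_of_valued_eq_one`), and
  **`exists_isUnit_restrictInteger_galAdicCompletionMap_sub`** (`a₀`, `ha₀` in the head's `Valued` shape VERBATIM: the reduction of `σ_w` is `Frob_{q_v} ≠ id` on `𝔽_{q_v²}`,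
  ★ `exists_frob_ne`; lift a moved residue).
HONEST LABEL: frame glue at the place; proves no printed statement, discharges no citation; count-neutral helper.
HC_CM is proved only modulo the 7 printed citations (2 remaining named inputs: hLiu418 = stmt-HodgeConjecture-24832, h413 = stmt-HodgeConjecture-24833) until rung 0 closes; REL ≠ ★ ≠ BUILT.

## References
* [Serre1979] J.-P. Serre, *Local Fields*, GTM 67 (1979): Ch. I §1 (valuation rings, units, uniformisers), Ch. V §2 Prop. 3 and Cor. (`U_K = N U_L` for unramified `L∕K`).
* [NeukirchANT1999] J. Neukirch, *Algebraic Number Theory* (1999): Ch. II §4 Prop. (4.3) (unramified extensions; the Frobenius of the residue extension).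
* [Flicker1998UnitaryFL] Y. Flicker, *The fundamental lemma for U(3)* (1998 notes ed.): Prop. 4–5 pp. 80–82 (the frame `u_m^{(y, z)}`, `y·ȳ = −2`).
* [Rogawski1990] J. D. Rogawski, *Automorphic Representations of Unitary Groups in Three Variables* (1990): §4.9 pp. 54–55.
-/

set_option autoImplicit false
-- the mandated namespace repeats the single-problem summit's segment (`HodgeConjecture.HodgeConjecture`)
set_option linter.dupNamespace false

noncomputable section

open Set Function NumberField IsDedekindDomain
open scoped Valued WithZero
open Literature.NumberTheory.Automorphic Literature.NumberTheory.Automorphic.UnitaryGroup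
open Literature.NumberTheory.Automorphic.UnitaryLatticeTree Literature.NumberTheory.Automorphic.CartanUnique

namespace Summit.HodgeConjecture.HodgeConjecture.R90.S6

/-! ## §1 The frame `R := 𝒪[K]` of the ★ a₀ heads: the one-liners (`Valued` currency, any valued field) -/

section Frame

variable {K : Type} [Field K] [Valued K ℤᵐ⁰] {σ : K →+* K}

/-- **`hιv` for `ι := 𝒪[K].subtype`**: `|x| ≤ 1 ↔ x ∈ range (𝒪[K] ↪ K)`. [cite: Serre1979, Ch. I §1] -/
theorem v_le_one_iff_mem_range_integer_subtype (x : K) : Valued.v x ≤ 1 ↔ x ∈ Set.range (𝒪[K].subtype : 𝒪[K] →+* K) :=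
  ⟨fun h => ⟨⟨x, (Valuation.mem_integer_iff _ _).2 h⟩, rfl⟩, by rintro ⟨y, rfl⟩; exact (Valuation.mem_integer_iff _ _).1 y.2⟩

/-- **`hσR` for `σR := σ|_𝒪`**: the restriction of an involution `σ` preserving `𝒪[K]` is an involution of `𝒪[K]`. [cite: Serre1979, Ch. I §1] -/
theorem restrictInteger_restrictInteger (hσO : ∀ x : 𝒪[K], σ x ∈ 𝒪[K]) (hσσ : ∀ x, σ (σ x) = x) (r : 𝒪[K]) :
    ((σ.comp 𝒪[K].subtype).codRestrict 𝒪[K] hσO) (((σ.comp 𝒪[K].subtype).codRestrict 𝒪[K] hσO) r) = r :=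
  Subtype.ext (hσσ r)

/-- **`hdRσ` for `dR := σa₀ − a₀`**: `σ(σa₀ − a₀) = −(σa₀ − a₀)` in `𝒪[K]` (`σ² = 1`). [cite: Serre1979, Ch. V §2] -/
theorem restrictInteger_sub_self_eq_neg (hσO : ∀ x : 𝒪[K], σ x ∈ 𝒪[K]) (hσσ : ∀ x, σ (σ x) = x) (a : 𝒪[K]) :
    ((σ.comp 𝒪[K].subtype).codRestrict 𝒪[K] hσO) (((σ.comp 𝒪[K].subtype).codRestrict 𝒪[K] hσO) a - a) =
      -(((σ.comp 𝒪[K].subtype).codRestrict 𝒪[K] hσO) a - a) := by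
  rw [map_sub, restrictInteger_restrictInteger hσO hσσ a]
  abel

/-- **`h2R`**: `2` is a unit of `𝒪[K]` when `|2| = 1` (residue characteristic `≠ 2`). [cite: Serre1979, Ch. I §1] -/
theorem isUnit_two_integer_of_v_eq_one (h2 : Valued.v (2 : K) = 1) : IsUnit (2 : 𝒪[K]) := by
  rw [isUnit_integer_iff]
  exact_mod_cast h2

end Frame

/-! ## §2 At an inert place `w ∣ v ∤ 2` of `E ∕ F`: `|2|_w = 1`, `y·σ_w y = −2`, and the unit mover `a₀` in `Valued` currency -/

section InertPlace

variable {F E : Type} [Field F] [NumberField F] [Field E] [NumberField E] [Algebra F E] [Algebra.IsQuadraticExtension F E]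
  (c : E ≃ₐ[F] E) (hc : c ≠ 1) (v : HeightOneSpectrum (𝓞 F)) (w : PlacesOver E v) (hw : c • w.1 = w.1) (hv : Algebra.IsUnramifiedIn (𝓞 E) v.asIdeal)

omit [NumberField F] [Algebra.IsQuadraticExtension F E] in
/-- **`h2` AT THE PLACE — `|2|_w = 1` above `v ∤ 2`** (`2 ∉ 𝔭_v ⇒ 2 ∉ 𝔭_w ⇒ w(2) = 1`, read in `E_w`; generic twin of the ★ CM lemma `valued_two_eq_one_of_not_mem`). [cite: Serre1979, Ch. I §1] -/
theorem valued_two_eq_one_of_not_mem_placesOver (h2 : (2 : 𝓞 F) ∉ v.asIdeal) : Valued.v (2 : w.1.adicCompletion E) = 1 := by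
  haveI := PlacesOver.liesOver (E := E) w
  have h2w : (2 : 𝓞 E) ∉ w.1.asIdeal := fun h => h2 ((Ideal.mem_of_liesOver w.1.asIdeal v.asIdeal (2 : 𝓞 F)).2 (by rwa [map_ofNat]))
  have h := (HeightOneSpectrum.valuation_eq_one_iff_notMem (K := E) (v := w.1)).2 h2w
  have hval : Valued.v (algebraMap E (w.1.adicCompletion E) (2 : E)) = w.1.valuation E (2 : E) := HeightOneSpectrum.valuedAdicCompletion_eq_valuation' w.1 _
  rw [map_ofNat] at hval
  rw [hval]
  simpa only [map_ofNat] using h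

include hc hv in
/-- **`hy` AT THE PLACE — there is `y ∈ E_w` with `y · σ_w y = −2`** (`v ∤ 2`): `−2` is a `σ_w`-fixed unit of `E_w`, and every `σ_w`-fixed unit is a norm from the unramified quadratic
`E_w ∕ F_v` (★ `exists_mul_galAdicCompletionMap_eq_of_valued_eq_one`).  The letter `hy` of the ★ a₀ ∕ FILE 0 (H.1) frame (`u_m^{(y,1)}`, `1 + 1 + y·ȳ = 0`).
[cite: Serre1979, Ch. V §2 Prop. 3, Cor.] [cite: Flicker1998UnitaryFL, Prop. 4 p. 80] -/
theorem exists_mul_galAdicCompletionMap_eq_neg_two (h2 : Valued.v (2 : w.1.adicCompletion E) = 1) :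
    ∃ y : w.1.adicCompletion E, y * galAdicCompletionMap (L := E) c hw y = -2 :=
  Literature.NumberTheory.LocalFields.UnramifiedQuadraticNorm.exists_mul_galAdicCompletionMap_eq_of_valued_eq_one c v hc
    (Literature.NumberTheory.Automorphic.algEquiv_mul_self_eq_one (F := F) hc) hv w hw (by rw [map_neg, map_ofNat]) (by rw [Valuation.map_neg, h2])

include hc hv in
/-- **`a₀`, `ha₀` AT THE PLACE, `Valued` currency — `σ_w` MOVES SOME INTEGER BY A UNIT**: there is `a₀ ∈ 𝒪[E_w] = Valued.integer E_w` with `σ_w a₀ − a₀ ∈ 𝒪[E_w]^×`, stated for the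
restriction `σO := (σ_w ∘ 𝒪.subtype).codRestrict 𝒪 hσO` exactly as the (E1) head binds it (`hσO` := ★ `galAdicCompletionMap_mem_valuedInteger`; any other proof of `hσO` gives the
same statement by proof irrelevance).  The reduction of `σ_w` is `Frob_{q_v}` on `𝓀[E_w] ≅ 𝔽_{q_v²}` (★ `residueHom_galAdicCompletionMap_eq_pow_valued`, ★
`fintypeCard_valuedResidueField_eq_sq_of_inert`), which moves some residue (★ `exists_frob_ne`); a lift `a₀` of it has `σ_w a₀ − a₀` of non-zero residue, i.e. a unit.
[cite: Serre1979, Ch. V §2, proof of Prop. 3] [cite: NeukirchANT1999, Ch. II §4 Prop. (4.3)] -/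
theorem exists_isUnit_restrictInteger_galAdicCompletionMap_sub :
    ∃ a₀ : 𝒪[w.1.adicCompletion E],
      IsUnit ((((galAdicCompletionMap (L := E) c hw).comp 𝒪[w.1.adicCompletion E].subtype).codRestrict 𝒪[w.1.adicCompletion E]
        (galAdicCompletionMap_mem_valuedInteger c v w hw)) a₀ - a₀) := by
  obtain ⟨σk, hσk⟩ := exists_residueField_ringHom_of_v_eq (σ := galAdicCompletionMap (L := E) c hw) fun y => valued_galAdicCompletionMap (L := E) c hw y
  letI : Fintype 𝓀[w.1.adicCompletion E] := Fintype.ofFinite _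
  have hq := fintypeCard_valuedResidueField_eq_sq_of_inert c v hc hv w hw
  have hfrob := residueHom_galAdicCompletionMap_eq_pow_valued c v hc hv w hw σk hσk
  obtain ⟨ybar, hy⟩ := Literature.LinearAlgebra.Matrix.exists_frob_ne hq σk hfrob
  obtain ⟨a, rfl⟩ := IsLocalRing.residue_surjective ybar
  refine ⟨a, ?_⟩
  -- `σ_w a − a` has residue `σk ā − ā ≠ 0`, so it is a unit of the local ring `𝒪[E_w]`
  by_contra h
  apply hy
  have hmem : (((galAdicCompletionMap (L := E) c hw).comp 𝒪[w.1.adicCompletion E].subtype).codRestrict 𝒪[w.1.adicCompletion E]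
      (galAdicCompletionMap_mem_valuedInteger c v w hw)) a - a ∈ IsLocalRing.maximalIdeal 𝒪[w.1.adicCompletion E] :=
    (IsLocalRing.mem_maximalIdeal _).2 h
  have h0 := (IsLocalRing.residue_eq_zero_iff _).2 hmem
  rw [map_sub, sub_eq_zero] at h0
  rw [← hσk a]
  exact h0

end InertPlace

end Summit.HodgeConjecture.HodgeConjecture.R90.S6

end
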